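import Mathlib
import Summits.AtomisticToContinuum.Crystallization.Theorems.FrustratedLawDichotomyPeriodicMuGSC
import Summits.AtomisticToContinuum.Crystallization.Theses.PeriodicChargeSplit

/-!
# PeriodicChargeSplit · crux `NoFrustratedPeriodicMinimiser` (stmt-AtomisticToContinuum-26654, the deterministic content D of the sibling
# `PeriodicFrustratedLawGap` of `AperiodicFrustratedLawGap`) — THE SURGERY-CURRENCY DOOR, UNCONDITIONAL
# (decomp-a2c, prover hand 2, structural share, generation 5)

`FrustratedLawDichotomyPeriodicMuGSC.isMuGSC_points_of_energyPerParticle_le` (this generation, door-free): a `δ`-separated periodic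
configuration with `e(Q) ≤ e⋆` has an `e⋆`-μGSC point set.  Hence the deterministic crux D = `NoFrustratedPeriodicMinimiser` («no textured Nash
periodic translate `Q + t` is an exact Lennard-Jones minimiser», BY NAME) follows from the periodic-translate residual in SURGERY CURRENCY —
«no `δ`-separated, textured, Nash translate `Q.points + t` of a periodic configuration is an `e⋆`-μGSC of `V_LJ`» (the crux's `let`s verbatim,
conclusion replaced) — WITHOUT the μ-equilibrium door of item 27073: `noFrustratedPeriodicMinimiser_of_noTexturedPeriodicGSC`.  So every
certified finite surgery (`FrustratedLawDichotomyGSCSurgeryTests` / `…Certificates`) on a textured periodic candidate is an unconditional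
rung of D.  Translation bookkeeping: `exists_translate` (a translate of a periodic configuration is a periodic configuration with the same
energy per particle).  All `[folklore]`.
-/

noncomputable section

namespace Summit.AtomisticToContinuum.Crystallization.Theorems.FrustratedLawDichotomyPeriodicChargeSplitGSCDoor

open Literature.MathematicalPhysics.StatisticalMechanics
open Summit.AtomisticToContinuum.Crystallization.Theorems.ChargedEnergyGapNegative (E3 eStar eStar_le)
open Summit.AtomisticToContinuum.Crystallization.Theorems.FrustratedLawDichotomyPeriodicMuGSC (isMuGSC_points_of_energyPerParticle_le)

/-- **A translate of a periodic configuration is a periodic configuration** with the translated point set and the same energy per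
particle. [folklore] -/
theorem exists_translate (Q : PeriodicConfiguration 3) (t : E3) :
    ∃ Q' : PeriodicConfiguration 3, Q'.points = (fun s => s + t) '' Q.points ∧
      ∀ V : ℝ → ℝ, Q'.energyPerParticle V = Q.energyPerParticle V := by
  classical
  have hinj : Function.Injective (fun s : E3 => s + t) := fun a b h => add_right_cancel h
  let Q' : PeriodicConfiguration 3 :=
    { lattice := Q.lattice, discrete := Q.discrete, isZLattice := Q.isZLattice, motif := Q.motif.image (fun s => s + t),
      motif_nonempty := Q.motif_nonempty.image _,
      eq_of_sub_mem := by
        intro x hx y hy hxy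
        obtain ⟨x0, hx0, rfl⟩ := Finset.mem_image.1 hx
        obtain ⟨y0, hy0, rfl⟩ := Finset.mem_image.1 hy
        have h : x0 - y0 ∈ Q.lattice := by
          have : x0 + t - (y0 + t) = x0 - y0 := by abel
          rwa [this] at hxy
        rw [Q.eq_of_sub_mem x0 hx0 y0 hy0 h] }
  have hpts : Q'.points = (fun s => s + t) '' Q.points := by
    ext z
    constructor
    · rintro ⟨y, hy, g, hg, rfl⟩
      obtain ⟨y0, hy0, rfl⟩ := Finset.mem_image.1 hy
      exact ⟨y0 + g, ⟨y0, hy0, g, hg, rfl⟩, by show y0 + g + t = y0 + t + g; abel⟩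
    · rintro ⟨z0, ⟨y0, hy0, g, hg, rfl⟩, rfl⟩
      exact ⟨y0 + t, Finset.mem_image_of_mem _ hy0, g, hg, by show y0 + g + t = y0 + t + g; abel⟩
  refine ⟨Q', hpts, fun V => ?_⟩
  -- site sums are translation invariant
  have hsite : ∀ x : E3, (∑' y : {y : E3 // y ∈ Q'.points ∧ y ≠ x + t}, V (dist (x + t) y.1)) =
      ∑' y : {y : E3 // y ∈ Q.points ∧ y ≠ x}, V (dist x y.1) := by
    intro x
    have hmem1 : ∀ z : E3, z ∈ Q.points → z + t ∈ Q'.points := fun z hz => by rw [hpts]; exact ⟨z, hz, rfl⟩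
    have hmem2 : ∀ z : E3, z ∈ Q'.points → z - t ∈ Q.points := fun z hz => by
      rw [hpts] at hz
      obtain ⟨z0, hz0, rfl⟩ := hz
      simpa using hz0
    let e : {y : E3 // y ∈ Q.points ∧ y ≠ x} ≃ {y : E3 // y ∈ Q'.points ∧ y ≠ x + t} :=
      { toFun := fun y => ⟨y.1 + t, hmem1 y.1 y.2.1, fun h => y.2.2 (add_right_cancel h)⟩
        invFun := fun y => ⟨y.1 - t, hmem2 y.1 y.2.1, fun h => y.2.2 (eq_add_of_sub_eq h)⟩
        left_inv := fun y => by ext1; simp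
        right_inv := fun y => by ext1; simp }
    rw [← e.tsum_eq]
    refine tsum_congr fun y => ?_
    show V (dist (x + t) (y.1 + t)) = V (dist x y.1)
    rw [dist_add_right]
  have hcard : (Q.motif.image (fun s => s + t)).card = Q.motif.card := Finset.card_image_of_injective _ hinj
  show (2 * ((Q.motif.image (fun s => s + t)).card : ℝ))⁻¹ *
      ∑ x ∈ Q.motif.image (fun s => s + t), (∑' y : {y : E3 // y ∈ Q'.points ∧ y ≠ x}, V (dist x y.1)) =
    (2 * (Q.motif.card : ℝ))⁻¹ * ∑ x ∈ Q.motif, (∑' y : {y : E3 // y ∈ Q.points ∧ y ≠ x}, V (dist x y.1))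
  rw [hcard, Finset.sum_image (fun a _ b _ h => hinj h)]
  congr 1
  exact Finset.sum_congr rfl fun x _ => hsite x

/-- **THE SURGERY-CURRENCY DOOR FOR `NoFrustratedPeriodicMinimiser` (item 26654), UNCONDITIONAL.**  If no `δ`-separated, textured, Nash
translate `Q.points + t` of a periodic configuration is an `e⋆`-μGSC of `V_LJ` (hypothesis: the crux's binders verbatim, conclusion replaced),
then `NoFrustratedPeriodicMinimiser` holds: were `e(Q) ≤ e⋆`, the translate `Q + t` would be an exact periodic minimiser, hence an `e⋆`-μGSC
(`isMuGSC_points_of_energyPerParticle_le`, door-free). [folklore] -/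
theorem noFrustratedPeriodicMinimiser_of_noTexturedPeriodicGSC
    (hR : ∀ δ : ℝ, 0 < δ → ∀ (Q : Literature.MathematicalPhysics.StatisticalMechanics.PeriodicConfiguration 3) (t : EuclideanSpace ℝ (Fin 3)), let Gy : ℝ → (N : ℕ) → (Fin N → EuclideanSpace ℝ (Fin 3)) → Fin N → Prop := fun η N y j => let d : ℝ := sInf ((fun z => dist z (y (j : Fin N))) '' (Set.range (y) \ {(y (j : Fin N))})); let T : Set (EuclideanSpace ℝ (Fin 3)) := {z : EuclideanSpace ℝ (Fin 3) | z ∈ Set.range (y) ∧ z ≠ (y (j : Fin N)) ∧ dist z (y (j : Fin N)) < 13 / 10 * d}; ∃ A : EuclideanSpace ℝ (Fin 3) →ₗᵢ[ℝ] EuclideanSpace ℝ (Fin 3), (∃ e : ↥T ≃ ↥Literature.Geometry.DiscreteGeometry.fccKissingPattern, ∀ t : ↥T, dist (d⁻¹ • ((t : EuclideanSpace ℝ (Fin 3)) - (y (j : Fin N)))) (A ((e t : ↥Literature.Geometry.DiscreteGeometry.fccKissingPattern) : EuclideanSpace ℝ (Fin 3))) ≤ η) ∨ (∃ e : ↥T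 ≃ ↥Literature.Geometry.DiscreteGeometry.hcpKissingPattern, ∀ t : ↥T, dist (d⁻¹ • ((t : EuclideanSpace ℝ (Fin 3)) - (y (j : Fin N)))) (A ((e t : ↥Literature.Geometry.DiscreteGeometry.hcpKissingPattern) : EuclideanSpace ℝ (Fin 3))) ≤ η); let TexBall : (N : ℕ) → (Fin N → EuclideanSpace ℝ (Fin 3)) → Fin N → ℝ → ℝ → ℝ → ℝ → Prop := fun N y i R R₇ R₈ R₉ => (∀ a b : Fin N, a ≠ b → (7 : ℝ) / 10 ≤ dist (y a) (y b)) ∧ (∀ j : Fin N, dist (y j) (y i) ≤ R → ¬ Gy (1 / 20) N (y) j) ∧ (∀ j : Fin N, dist (y j) (y i) ≤ R → ¬ ((∀ j' : Fin N, dist (y j') (y j) ≤ R₇ → ¬ Gy (1 / 20) N (y) j') ∧ (∀ z : EuclideanSpace ℝ (Fin 3), dist z (y j) ≤ R₇ → ∃ k : Fin N, dist z (y k) ≤ 1) ∧ (∀ j' : Fin N, dist (y j') (y j) ≤ R₇ → (let d : ℝ := sInf ((fun z => dist z (y j')) '' (Set.range (y) \ {(y j')})); ∀ k : Fin N, y k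 ≠ y j' → dist (y k) (y j') < 27 / 20 * d → 5 ≤ Nat.card {m : Fin N // y m ≠ y j' ∧ dist (y m) (y j') < 27 / 20 * d ∧ y m ≠ y k ∧ dist (y m) (y k) < 27 / 20 * d})))) ∧ (∀ j : Fin N, dist (y j) (y i) ≤ R → ∃ k : Fin N, dist (y k) (y j) ≤ R₈ ∧ Gy (1 / 8) N (y) k) ∧ (∀ j : Fin N, dist (y j) (y i) ≤ R → ¬ ((∀ j' : Fin N, dist (y j') (y j) ≤ R₉ → ¬ Gy (1 / 20) N (y) j') ∧ (Nat.card {j' : Fin N // dist (y j') (y j) ≤ R₉ ∧ ¬ Gy (1 / 8) N (y) j'} : ℝ) ≤ 1 / 2 * (Nat.card {j' : Fin N // dist (y j') (y j) ≤ R₉} : ℝ) ∧ (∀ j' : Fin N, dist (y j') (y j) ≤ R₉ → ¬ Gy (1 / 8) N (y) j' → ¬ (let d : ℝ := sInf ((fun z => dist z (y j')) '' (Set.range (y) \ {(y j')})); ∀ k : Fin N, y k ≠ y j' → dist (y k) (y j') < 27 / 20 * d → 5 ≤ Nat.card {m : Fin N // y m ≠ y j' ∧ dist (y m) (y j') < 27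 / 20 * d ∧ y m ≠ y k ∧ dist (y m) (y k) < 27 / 20 * d})))); let ApprS : Set (EuclideanSpace ℝ (Fin 3)) → ℝ → ℝ → ℝ → Prop := fun S R₇ R₈ R₉ => ∀ q : EuclideanSpace ℝ (Fin 3), q ∈ S → ∀ R ε : ℝ, 0 < ε → ∃ (N : ℕ) (y : Fin N → EuclideanSpace ℝ (Fin 3)) (i : Fin N), TexBall N y i R R₇ R₈ R₉ ∧ (∀ p : EuclideanSpace ℝ (Fin 3), p ∈ S → dist p q ≤ R → ∃ k : Fin N, dist (y k - y i) (p - q) ≤ ε) ∧ (∀ k : Fin N, dist (y k) (y i) ≤ R → ∃ p : EuclideanSpace ℝ (Fin 3), p ∈ S ∧ dist (y k - y i) (p - q) ≤ ε); let NashS : Set (EuclideanSpace ℝ (Fin 3)) → Prop := fun S => ∀ p : EuclideanSpace ℝ (Fin 3), p ∈ S → ∀ y : EuclideanSpace ℝ (Fin 3), (∀ q : EuclideanSpace ℝ (Fin 3), q ∈ S → q ≠ p → y ≠ q) → ∑' q : {q : EuclideanSpace ℝ (Fin 3) // q ∈ S ∧ q ≠ p}, Literature.MathematicalPhysics.StatisticalMechanics.lennardJones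 (dist p (q : EuclideanSpace ℝ (Fin 3))) ≤ ∑' q : {q : EuclideanSpace ℝ (Fin 3) // q ∈ S ∧ q ≠ p}, Literature.MathematicalPhysics.StatisticalMechanics.lennardJones (dist y (q : EuclideanSpace ℝ (Fin 3))); (∀ p ∈ ((fun s => s + t) '' Q.points), ∀ q ∈ ((fun s => s + t) '' Q.points), p ≠ q → δ ≤ dist p q) → (∃ R₇ R₈ R₉ : ℝ, ApprS ((fun s => s + t) '' Q.points) R₇ R₈ R₉) → NashS ((fun s => s + t) '' Q.points) → ¬ Literature.MathematicalPhysics.StatisticalMechanics.IsMuGSC Literature.MathematicalPhysics.StatisticalMechanics.lennardJones (⨅ Q : Literature.MathematicalPhysics.StatisticalMechanics.PeriodicConfiguration 3, Q.energyPerParticle Literature.MathematicalPhysics.StatisticalMechanics.lennardJones) ((fun s => s + t) '' Q.points)) :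
    Summit.AtomisticToContinuum.Crystallization.Theses.PeriodicChargeSplit.NoFrustratedPeriodicMinimiser := by
  intro δ hδ Q t
  have hR' := hR δ hδ Q t
  dsimp only at hR' ⊢
  intro hsep happr hnash
  by_contra hle
  rw [not_lt] at hle
  obtain ⟨Q', hpts, hen⟩ := exists_translate Q t
  have hsep' : ∀ p ∈ Q'.points, ∀ q ∈ Q'.points, p ≠ q → δ ≤ dist p q := by rw [hpts]; exact hsep
  have hopt : Q'.energyPerParticle lennardJones ≤ ⨅ Q'' : PeriodicConfiguration 3, Q''.energyPerParticle lennardJones := by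
    rw [hen]; exact hle
  have hG := isMuGSC_points_of_energyPerParticle_le Q' hδ hsep' hopt
  rw [hpts] at hG
  exact hR' hsep happr hnash hG

end Summit.AtomisticToContinuum.Crystallization.Theorems.FrustratedLawDichotomyPeriodicChargeSplitGSCDoor

end
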